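import Summits.HubbardSuperconductivity.HubbardSuperconductivity.Theorems.BirComplexStableXY.Negative.BirComplexStableXYFalseOfWitnessZeroExists

/-!
# Admissibility of the holomorphic stiffness family
(`BalabanIR.BirComplexStableXY`, stmt-HubbardSuperconductivity-2080, line `theta-rotor-equimodular-zeros`, S1h)

For the stiffness-deformed witness table of the negative lane
(`Theorems/BirComplexStableXY/Negative/WitnessTable.lean`),
`c(a, ε₂) = spatialTab + a • temporalCosTab + (iε₂) • temporalSinTab` (`a ∈ ℂ` the complex temporal
stiffness; at `a = 1 + iε₁` this is `witness ε₁ ε₂`), the crux's four hypotheses hold on the disc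
`‖a − 1‖ ≤ 1/4`, `|ε₂| ≤ 1/5`:
* (U1) every frequency in the support is charge neutral (`condU1_add`, `condU1_smul`, `condU1_map_cosTab`,
  `condU1_map_sinTab`);
* (N) `Σ_n c_n = 0` (`tsum_cosTab`, `tsum_sinTab`);
* (A) the `e^{|n|₁}`-weighted `ℓ¹` norm is `≤ 8(1+e²) + (5/4)·4(1+e²) + (1/5)·4e² = 13 + 13.8 e² < 115 ≤ 128`
  (`normA_spatialTab`, `normA_temporalCosTab`, `normA_temporalSinTab`, `exp_two_lt`, `‖a‖ ≤ 5/4`);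
* (C) coercivity with `c₀ = 1/24`: `Re F(c(a,ε₂)) = S_spatial + (Re a) · T_cos` with `S_spatial, T_cos ≥ 0`
  sums of `1 − cos` over the eight spatial / four temporal cube edges and `Re a ≥ 3/4`, so
  `Re F ≥ (3/4)(S_spatial + T_cos) = (3/4) S12 ≥ (3/4)(1/18) ΣΣ(1 − cos)` by the tree's `condC_witness 0 0`.
No definitions, no hypotheses.
-/

namespace Summit.HubbardSuperconductivity.BirComplexStableXYNegative

open scoped BigOperators
open MeasureTheory Literature.Probability.LatticeModels
open Summit.HubbardSuperconductivity.HubbardSuperconductivity.Theses.BalabanIR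

noncomputable section

/-! ### (U1) and (N) -/

/-- (U1) for the stiffness family: every building block is charge neutral. -/
theorem stiffAdm_condU1 (a : ℂ) (ε₂ : ℝ) :
    (∀ m ∈ (spatialTab + a • temporalCosTab + (Complex.I * ε₂) • temporalSinTab).support,
      ∑ w, m w = 0) :=
  condU1_add (condU1_add (condU1_map_cosTab _) (condU1_smul _ (condU1_map_cosTab _)))
    (condU1_smul _ (condU1_map_sinTab _))

/-- (N) for the stiffness family: every building block vanishes at constants. -/
theorem stiffAdm_condN (a : ℂ) (ε₂ : ℝ) :
    (spatialTab + a • temporalCosTab + (Complex.I * ε₂) • temporalSinTab).sum (fun _ c => c) = 0 := by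
  change tsum (spatialTab + a • temporalCosTab + (Complex.I * ε₂) • temporalSinTab) = 0
  simp only [spatialTab, temporalCosTab, temporalSinTab, spatialEdges, temporalEdges,
    tsum_add, tsum_smul, List.map_cons, List.map_nil, List.sum_cons, List.sum_nil,
    tsum_cosTab, tsum_sinTab, tsum_zero]
  ring

/-! ### (A) the weighted norm -/

/-- `‖a‖ ≤ 5/4` on the stiffness disc `‖a − 1‖ ≤ 1/4`. -/
theorem stiffAdm_norm_le {a : ℂ} (ha : ‖a - 1‖ ≤ 1/4) : ‖a‖ ≤ 5/4 :=
  calc ‖a‖ = ‖(a - 1) + 1‖ := by rw [sub_add_cancel]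
    _ ≤ ‖a - 1‖ + ‖(1 : ℂ)‖ := norm_add_le _ _
    _ ≤ 5/4 := by rw [norm_one]; linarith

/-- (A) for the stiffness family: `normA ≤ 8(1+e²) + (5/4)·4(1+e²) + (1/5)·4e² < 128`. -/
theorem stiffAdm_condA {a : ℂ} {ε₂ : ℝ} (ha : ‖a - 1‖ ≤ 1/4) (h₂ : |ε₂| ≤ 1/5) :
    normA (spatialTab + a • temporalCosTab + (Complex.I * ε₂) • temporalSinTab) ≤ 128 := by
  have hS := normA_spatialTab
  have hC := normA_temporalCosTab
  have hT := normA_temporalSinTab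
  have hn₁ := stiffAdm_norm_le ha
  have hn₂ : ‖Complex.I * (ε₂ : ℂ)‖ ≤ 1/5 := by simpa using h₂
  have he := exp_two_lt
  have hC0 := normA_nonneg temporalCosTab
  have hT0 := normA_nonneg temporalSinTab
  have step1 := normA_add_le (spatialTab + a • temporalCosTab) ((Complex.I * ε₂) • temporalSinTab)
  have step2 := normA_add_le spatialTab (a • temporalCosTab)
  rw [normA_smul] at step1 step2
  have b1 : ‖a‖ * normA temporalCosTab ≤ (5/4) * (4 * (1 + Real.exp 2)) :=
    mul_le_mul hn₁ hC hC0 (by norm_num)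
  have b2 : ‖Complex.I * (ε₂ : ℂ)‖ * normA temporalSinTab ≤ (1/5) * (4 * Real.exp 2) :=
    mul_le_mul hn₂ hT hT0 (by norm_num)
  linarith

/-! ### (C) coercivity of the real part -/

/-- `F` of a list sum of `cosTab`s is the real number `Σ (1 − cos Δφ)`. -/
theorem stiffAdm_genF_map_cosTab (l : List (W 2 × W 2)) (φ : W 2 → ℝ) :
    genF ((l.map fun e => cosTab e.1 e.2).sum) φ =
      (((l.map fun e => (1 - Real.cos (φ e.1 - φ e.2))).sum : ℝ) : ℂ) := by
  induction l with
  | nil => simp [genF_zero]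
  | cons e l ih => simp [List.sum_cons, genF_add, genF_cosTab, ih]

/-- `F` of a list sum of `sinTab`s is the real number `Σ sin Δφ`. -/
theorem stiffAdm_genF_map_sinTab (l : List (W 2 × W 2)) (φ : W 2 → ℝ) :
    genF ((l.map fun e => sinTab e.1 e.2).sum) φ =
      (((l.map fun e => Real.sin (φ e.1 - φ e.2)).sum : ℝ) : ℂ) := by
  induction l with
  | nil => simp [genF_zero]
  | cons e l ih => simp [List.sum_cons, genF_add, genF_sinTab, ih]

/-- a list sum of `1 − cos` terms is non-negative. -/
theorem stiffAdm_sum_one_sub_cos_nonneg (l : List (W 2 × W 2)) (φ : W 2 → ℝ) :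
    0 ≤ (l.map fun e => (1 - Real.cos (φ e.1 - φ e.2))).sum :=
  List.sum_nonneg fun x hx => by
    obtain ⟨e, -, rfl⟩ := List.mem_map.1 hx
    exact sub_nonneg.2 (Real.cos_le_one _)

/-- real part of `F` of the stiffness family: `S_spatial + (Re a) · T_cos` (the sine part is purely
imaginary after multiplication by `iε₂`, the cosine parts are real). -/
theorem stiffAdm_genF_re (a : ℂ) (ε₂ : ℝ) (φ : W 2 → ℝ) :
    (genF (spatialTab + a • temporalCosTab + (Complex.I * ε₂) • temporalSinTab) φ).re =
      (spatialEdges.map fun e => (1 - Real.cos (φ e.1 - φ e.2))).sum +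
        a.re * (temporalEdges.map fun e => (1 - Real.cos (φ e.1 - φ e.2))).sum := by
  simp only [genF_add, genF_smul, spatialTab, temporalCosTab, temporalSinTab,
    stiffAdm_genF_map_cosTab, stiffAdm_genF_map_sinTab, Complex.add_re, Complex.mul_re,
    Complex.mul_im, Complex.ofReal_re, Complex.ofReal_im, Complex.I_re, Complex.I_im]
  ring

/-- the twelve-edge sum `S12` split as the spatial plus the temporal list sum. -/
theorem stiffAdm_S12_eq (φ : W 2 → ℝ) :
    S12 φ = (spatialEdges.map fun e => (1 - Real.cos (φ e.1 - φ e.2))).sum +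
      (temporalEdges.map fun e => (1 - Real.cos (φ e.1 - φ e.2))).sum := by
  simp only [S12, spatialEdges, temporalEdges, List.map_cons, List.map_nil, List.sum_cons,
    List.sum_nil, vx]
  ring

/-- `Re a ≥ 3/4` on the stiffness disc `‖a − 1‖ ≤ 1/4`. -/
theorem stiffAdm_re_ge {a : ℂ} (ha : ‖a - 1‖ ≤ 1/4) : 3/4 ≤ a.re := by
  have h1 : |(a - 1).re| ≤ ‖a - 1‖ := Complex.abs_re_le_norm (a - 1)
  rw [Complex.sub_re, Complex.one_re] at h1
  have := (abs_le.1 (h1.trans ha)).1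
  linarith

/-- (C) COERCIVITY of the stiffness family with `c₀ = 1/24 = (3/4)·(1/18)`. -/
theorem stiffAdm_condC {a : ℂ} (ha : ‖a - 1‖ ≤ 1/4) (ε₂ : ℝ) (φ : W 2 → ℝ) :
    (1/24 : ℝ) * ∑ w, ∑ w', (1 - Real.cos (φ w - φ w')) ≤
      (genF (spatialTab + a • temporalCosTab + (Complex.I * ε₂) • temporalSinTab) φ).re := by
  have hC := condC_witness 0 0 φ
  rw [genF_witness_re, stiffAdm_S12_eq] at hC
  rw [stiffAdm_genF_re]
  have hS := stiffAdm_sum_one_sub_cos_nonneg spatialEdges φ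
  have hT := stiffAdm_sum_one_sub_cos_nonneg temporalEdges φ
  have hre := stiffAdm_re_ge ha
  nlinarith [mul_nonneg (sub_nonneg.2 hre) hT, hS, hT, hC]

/-! ### Main theorem -/

/-- S1h: ADMISSIBILITY of the holomorphic stiffness family
`c(a, ε₂) = spatialTab + a • temporalCosTab + (iε₂) • temporalSinTab` on the disc `‖a − 1‖ ≤ 1/4`,
`|ε₂| ≤ 1/5`: the crux's hypotheses (U1), (N), (A) with `B = 128`, (C) with `c₀ = 1/24`. -/
theorem stub_stiffTab_admissible :
    ∀ (a : ℂ) (ε₂ : ℝ), ‖a - 1‖ ≤ 1/4 → |ε₂| ≤ 1/5 →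
      (∀ m ∈ (spatialTab + a • temporalCosTab + (Complex.I * ε₂) • temporalSinTab).support, ∑ w, m w = 0) ∧
      (spatialTab + a • temporalCosTab + (Complex.I * ε₂) • temporalSinTab).sum (fun _ c => c) = 0 ∧
      (spatialTab + a • temporalCosTab + (Complex.I * ε₂) • temporalSinTab).sum
          (fun n c => ‖c‖ * Real.exp (∑ w, |(n w : ℝ)|)) ≤ 128 ∧
      (∀ φ : W 2 → ℝ, (1/24 : ℝ) * ∑ w, ∑ w', (1 - Real.cos (φ w - φ w')) ≤
          (genF (spatialTab + a • temporalCosTab + (Complex.I * ε₂) • temporalSinTab) φ).re) :=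
  fun a ε₂ ha h₂ =>
    ⟨stiffAdm_condU1 a ε₂, stiffAdm_condN a ε₂, stiffAdm_condA ha h₂, fun φ => stiffAdm_condC ha ε₂ φ⟩

end

end Summit.HubbardSuperconductivity.BirComplexStableXYNegative
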